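import Literature.AlgebraicGeometry.Resolution.KrullAkizukiLemma
import Literature.AlgebraicGeometry.Resolution.QuadraticTransforms
import Mathlib.RingTheory.Length
import Mathlib.RingTheory.LocalRing.ResidueField.Basic
import HarnessLib

/-!
# [OURS · L1 W4.2] KRULL–AKIZUKI THROUGH FRACTIONS: values and residues of fractions of a one-dimensional Noetherian domain in a
# valuation ring of a BIGGER field (the two commutative-algebra bricks of the kernel census «no isolated point tower follows a curve»)

Crux chain w42 (`SigmaMaxModifications`, stmt-ResolutionOfSingularities-18506; conjunct `SigmaMaxModificationsCorridor3`, stmt-…-19249),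
line `w_ladder`, registered stub `stub_isoSepRecurrent` (K2-sep ∧ K3-sep) of skeleton v8.8 — kernel census «NO ISOLATED E3 POINT TOWER FOLLOWS A
CURVE» (lead res-L1-w42-lead-1, gen 6): along a tower read on a curve through the marked points, satellite steps and residue jumps are finite in
number, so the tail is free-rational and K1 (`IsoTailsHS.isoFreeRationalTailsImpossible_holds`) kills it. This file: the two Krull–Akizuki bricks,
pure commutative algebra; the chain-level and scheme-level files are the companions. Helper file `--supports stmt-ResolutionOfSingularities-19249`;
kernel only (no definition, no named fact).

WHAT IS PROVED. `S` a Noetherian domain of Krull dimension `≤ 1`, `j : S ↪ F` an embedding into ANY field, `W` a valuation ring of `F` containing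
`j(S)`; "fraction of `S`" = an element `w ∈ F` with `w · j(b) = j(a)`, `j(b) ≠ 0`. (§0) comparison of values through a pulled-back valuation ring
`W.comap ι` (`comap_valuation_le_iff` / `_lt_iff`). (§1 a) `false_of_strictMono_valuation_of_fractions` — there is no sequence of fractions
`f₀, f₁, … ∈ W` with `v(j d) ≤ v(f₀) < v(f₁) < ⋯` (Mathlib's multiplicative order) for a nonzero `d ∈ S`: the tree's Krull–Akizuki discreteness
`not_strictMono_valuation_of_krullDimLE_one` (stated for `F = Frac S`) pulled back along `Frac S → F`. (§1 b) `card_le_length_of_residue_independent`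
— THE RESIDUE BOUND: if `0 ≠ d ∈ S` has `v(j d) < 1` and `w₁, …, w_m ∈ W` are fractions of `S` whose residues in `κ(W)` are linearly independent over
`S` (a relation `∑ j(cᵢ) wᵢ ∈ 𝔪_W` forces all `j(cᵢ) ∈ 𝔪_W`), then `m ≤ ℓ_S(S/dS)` — Matsumura's proof of Krull–Akizuki for `n = 1`: `E = S + ∑ S wᵢ`
read in `Frac S` has `ℓ(E/dE) = ℓ(S/dS)` (tree lemma `length_quotSMulTop_eq_of_fg`) and `E/dE` maps onto the span of the residues, a vector space of
dimension `≥ m` over the residue field of the (maximal) centre `S ∩ 𝔪_W`.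

HONEST FRAMING. OURS plumbing over textbook commutative algebra (Krull–Akizuki: Matsumura Thm. 11.7 and its Lemma; Abhyankar 1956 Thm. 1);
nothing here is a statement of H. Hironaka's manuscript [Hironaka2017] nor of [CossartJannsenSaito2020] / [CossartPiltant2009]. AI-written; AI
review is weaker than expert review.
References: H. Matsumura, *Commutative ring theory*, Thm. 11.7 [Matsumura1987]; S. S. Abhyankar, *On the valuations centered in a local domain*,
Amer. J. Math. 78 (1956), Thm. 1 [Abhyankar1956Valuations].
-/

noncomputable section

set_option linter.dupNamespace false

open IsLocalRing Pointwise
open Literature.AlgebraicGeometry.Resolution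

namespace Summit.ResolutionOfSingularities.ResolutionOfSingularities.Cruxes.SigmaMaxModifications.IdeasL1C5

universe u v

/-! ## §0. Comparing values through a pulled-back valuation ring -/

section Comap

variable {K : Type u} {F : Type v} [Field K] [Field F]

/-- `v(x) ≤ v(y)` in a valuation ring `A` of a field iff `y = 0 → x = 0` and `y ≠ 0 → x / y ∈ A`. [folklore] -/
theorem valuation_le_valuation_iff (A : ValuationSubring F) (x y : F) :
    A.valuation x ≤ A.valuation y ↔ (y = 0 → x = 0) ∧ (y ≠ 0 → x / y ∈ A) := by
  by_cases hy : y = 0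
  · subst hy
    simp
  · have hvy : 0 < A.valuation y := pos_iff_ne_zero.mpr ((map_ne_zero _).mpr hy)
    rw [← A.valuation_le_one_iff, map_div₀, div_le_one₀ hvy]
    simp [hy]

/-- Pulling back a valuation ring along a field map preserves the comparison of values. [folklore] -/
theorem comap_valuation_le_iff (A : ValuationSubring F) (ι : K →+* F) (x y : K) :
    (A.comap ι).valuation x ≤ (A.comap ι).valuation y ↔ A.valuation (ι x) ≤ A.valuation (ι y) := by
  rw [valuation_le_valuation_iff, valuation_le_valuation_iff, map_ne_zero ι, map_eq_zero_iff ι ι.injective,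
    map_eq_zero_iff ι ι.injective, ← map_div₀, ValuationSubring.mem_comap]

/-- … and the strict comparison. [folklore] -/
theorem comap_valuation_lt_iff (A : ValuationSubring F) (ι : K →+* F) (x y : K) :
    (A.comap ι).valuation x < (A.comap ι).valuation y ↔ A.valuation (ι x) < A.valuation (ι y) := by
  rw [lt_iff_le_not_ge, lt_iff_le_not_ge, comap_valuation_le_iff, comap_valuation_le_iff]

end Comap

/-! ## §1. Krull–Akizuki, read through fractions in a bigger field -/

section KrullAkizuki

variable {S : Type u} [CommRing S] [IsDomain S] [IsNoetherianRing S] [Ring.KrullDimLE 1 S]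
  {F : Type u} [Field F] (j : S →+* F)

/-- **(a) No infinite strictly monotone sequence of values of FRACTIONS of a one-dimensional Noetherian domain `S` below the value of a
nonzero element of `S`**, for a valuation ring `W ⊇ S` of any field `F ⊇ S` (the tree's Krull–Akizuki discreteness
`not_strictMono_valuation_of_krullDimLE_one`, stated there for `F = Frac S`, pulled back along `Frac S → F`).
[cite: Abhyankar1956Valuations, Thm. 1] [cite: Matsumura1987, Thm. 11.7] -/
theorem false_of_strictMono_valuation_of_fractions (hj : Function.Injective j) (W : ValuationSubring F) (hSW : ∀ s, j s ∈ W)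
    {d : S} (hd : d ≠ 0) (f : ℕ → F) (hfW : ∀ i, f i ∈ W)
    (hfrac : ∀ i, ∃ a b : S, j b ≠ 0 ∧ f i * j b = j a)
    (hdf : W.valuation (j d) ≤ W.valuation (f 0))
    (hmono : ∀ i, W.valuation (f i) < W.valuation (f (i + 1))) : False := by
  classical
  let K := FractionRing S
  let ι : K →+* F := IsFractionRing.lift hj
  have hι : ∀ s : S, ι (algebraMap S K s) = j s := fun s => IsFractionRing.lift_algebraMap hj s
  let W' : ValuationSubring K := W.comap ι
  -- the fractions, read in `K`
  choose a b hb hab using hfrac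
  let g : ℕ → K := fun i => algebraMap S K (a i) / algebraMap S K (b i)
  have hg : ∀ i, ι (g i) = f i := by
    intro i
    simp only [g, map_div₀, hι]
    rw [div_eq_iff (hb i), hab i]
  have hSW' : ∀ s : S, algebraMap S K s ∈ W' := fun s => by
    change ι _ ∈ W
    rw [hι]; exact hSW s
  have hgW' : ∀ i, g i ∈ W' := fun i => by
    change ι _ ∈ W
    rw [hg]; exact hfW i
  refine not_strictMono_valuation_of_krullDimLE_one (S := S) (K := K) W' hSW' hd g hgW' ?_ ?_
  · rw [comap_valuation_le_iff, hι, hg]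
    exact hdf
  · intro i
    rw [comap_valuation_lt_iff, hg, hg]
    exact hmono i


/-- **(b) RESIDUE BOUND (Krull–Akizuki, `n = 1`).** `S` a one-dimensional Noetherian domain inside a field `F`, `W` a valuation ring of `F`
containing `S`, `0 ≠ d ∈ S` of `W`-value `< 1` (so the centre `𝔪 = S ∩ 𝔪_W` is a maximal ideal). If `w₁, …, w_m ∈ W` are FRACTIONS of `S`
whose residues in `κ(W)` are linearly independent over `S/𝔪` — a relation `∑ cᵢ wᵢ ∈ 𝔪_W` with `cᵢ ∈ S` forces all `cᵢ ∈ 𝔪` — then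
`m ≤ ℓ_S(S/dS)`. (Proof, Matsumura's: `E = S·1 + ∑ S·wᵢ ⊆ Frac S` is a nonzero finitely generated fractional module, so `ℓ(E/dE) = ℓ(S/dS)` by
the Krull–Akizuki lemma; `E/dE` maps ONTO the `S/𝔪`-span of the residues, of dimension `≥ m`.) In particular `[κ(W) : S/𝔪] ≤ ℓ(S/dS)` on
fractions. [cite: Matsumura1987, Thm. 11.7] [cite: Abhyankar1956Valuations, Thm. 1] -/
theorem card_le_length_of_residue_independent (hj : Function.Injective j) (W : ValuationSubring F) (hSW : ∀ s, j s ∈ W)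
    {d : S} (hd : d ≠ 0) (hdW : W.valuation (j d) < 1) {m : ℕ} (w : Fin m → F) (hwW : ∀ i, w i ∈ W)
    (hfrac : ∀ i, ∃ a b : S, j b ≠ 0 ∧ w i * j b = j a)
    (hind : ∀ c : Fin m → S, W.valuation (∑ i, j (c i) * w i) < 1 → ∀ i, W.valuation (j (c i)) < 1) :
    (m : ℕ∞) ≤ Module.length S (S ⧸ Ideal.span {d}) := by
  classical
  -- the centre `𝔪` of `W` on `S`: a maximal ideal
  let jW : S →+* W := j.codRestrict W.toSubring hSW
  have hjW : ∀ s, ((jW s : W) : F) = j s := fun s => rfl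
  let 𝔪 : Ideal S := (maximalIdeal W).comap jW
  have hmem𝔪 : ∀ s, s ∈ 𝔪 ↔ W.valuation (j s) < 1 := fun s => by
    change jW s ∈ maximalIdeal W ↔ _
    rw [ValuationSubring.valuation_lt_one_iff]; rfl
  haveI h𝔪p : 𝔪.IsPrime := Ideal.comap_isPrime _ _
  have hd𝔪 : d ∈ 𝔪 := (hmem𝔪 d).mpr hdW
  haveI h𝔪max : 𝔪.IsMaximal := h𝔪p.isMaximal_of_ne_bot fun h => hd (by simpa [h] using hd𝔪)
  -- `κ(W)` as an `S`-module through `ρ = residue ∘ j`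
  let ρ : S →+* ResidueField W := (residue W).comp jW
  letI : Algebra S (ResidueField W) := ρ.toAlgebra
  have hρ : ∀ s, algebraMap S (ResidueField W) s = residue W (jW s) := fun s => rfl
  have hρ𝔪 : ∀ s ∈ 𝔪, algebraMap S (ResidueField W) s = 0 := fun s hs => by
    rw [hρ, residue_eq_zero_iff]; exact hs
  -- the fractions, read in `K = Frac S`
  let K := FractionRing S
  let ι : K →+* F := IsFractionRing.lift hj
  have hι : ∀ s : S, ι (algebraMap S K s) = j s := fun s => IsFractionRing.lift_algebraMap hj s
  choose a b hb hab using hfrac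
  let g : Fin m → K := fun i => algebraMap S K (a i) / algebraMap S K (b i)
  have hg : ∀ i, ι (g i) = w i := by
    intro i
    simp only [g, map_div₀, hι]
    rw [div_eq_iff (hb i), hab i]
  -- the `S`-submodule `M = ι⁻¹ W` of `K` and the residue map `ψ₀ : M → κ(W)`
  let M : Submodule S K :=
    { carrier := {x | ι x ∈ W}
      add_mem' := fun {x y} hx hy => by
        change ι (x + y) ∈ W
        rw [map_add]; exact W.add_mem _ _ hx hy
      zero_mem' := by change ι 0 ∈ W; rw [map_zero]; exact W.zero_mem
      smul_mem' := fun c {x} hx => by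
        change ι (c • x) ∈ W
        rw [Algebra.smul_def, map_mul, hι]; exact W.mul_mem _ _ (hSW c) hx }
  have hM : ∀ x, x ∈ M ↔ ι x ∈ W := fun x => Iff.rfl
  let ψ₀ : M →ₗ[S] ResidueField W :=
    { toFun := fun x => residue W ⟨ι x, x.2⟩
      map_add' := fun x y => by
        rw [← map_add]; congr 1; apply Subtype.ext
        change ι (x + y : K) = ι x + ι y
        rw [map_add]
      map_smul' := fun c x => by
        rw [RingHom.id_apply, Algebra.smul_def, hρ, ← map_mul]; congr 1; apply Subtype.ext
        change ι (c • (x : K)) = j c * ι x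
        rw [Algebra.smul_def, map_mul, hι] }
  have hψ₀ : ∀ x : M, ψ₀ x = residue W ⟨ι x, x.2⟩ := fun x => rfl
  -- `E = span {1, g i} ≤ M`
  let E : Submodule S K := Submodule.span S (insert 1 (Set.range g))
  have hEM : E ≤ M := by
    rw [Submodule.span_le]
    rintro x (rfl | ⟨i, rfl⟩)
    · change ι 1 ∈ W; rw [map_one]; exact W.one_mem
    · change ι (g i) ∈ W; rw [hg]; exact hwW i
  have hEfg : E.FG := ⟨insert 1 (Finset.univ.image g), by simp [E]⟩
  have hE0 : E ≠ ⊥ := by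
    intro h
    have h1 : (1 : K) ∈ E := Submodule.subset_span (Set.mem_insert _ _)
    rw [h, Submodule.mem_bot] at h1
    exact one_ne_zero h1
  let ψ : E →ₗ[S] ResidueField W := ψ₀.comp (Submodule.inclusion hEM)
  have hψ : ∀ x : E, ψ x = residue W ⟨ι x, hEM x.2⟩ := fun x => rfl
  -- `ψ` kills `d • E`
  have hψd : d • (⊤ : Submodule S E) ≤ LinearMap.ker ψ := by
    intro x hx
    obtain ⟨y, -, rfl⟩ := (Submodule.mem_smul_pointwise_iff_exists x d ⊤).mp hx
    rw [LinearMap.mem_ker, map_smul, Algebra.smul_def, hρ𝔪 d hd𝔪, zero_mul]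
  -- Krull–Akizuki: `ℓ(E/dE) = ℓ(S/dS)`, and `E/dE ↠ V := ψ(E)`
  have hKA := length_quotSMulTop_eq_of_fg (S := S) (K := K) E hEfg hE0 hd
  let ψbar : QuotSMulTop d E →ₗ[S] ResidueField W := Submodule.liftQ _ ψ hψd
  let V : Submodule S (ResidueField W) := LinearMap.range ψbar
  have hlenV : Module.length S V ≤ Module.length S (S ⧸ Ideal.span {d}) := by
    rw [← hKA]
    exact Module.length_le_of_surjective _ (LinearMap.surjective_rangeRestrict ψbar)
  have hψV : ∀ x : E, ψ x ∈ V := fun x => ⟨Submodule.Quotient.mk x, by simp [ψbar]⟩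
  -- `V` is a vector space over `k = S/𝔪`
  have hV : Module.IsTorsionBySet S V 𝔪 := by
    rintro x ⟨s, hs⟩
    apply Subtype.ext
    change s • (x : ResidueField W) = 0
    rw [Algebra.smul_def, hρ𝔪 s hs, zero_mul]
  letI : Module (S ⧸ 𝔪) V := hV.module
  haveI : IsScalarTower S (S ⧸ 𝔪) V := hV.isScalarTower
  letI : Field (S ⧸ 𝔪) := Ideal.Quotient.field 𝔪
  haveI : Module.Finite S E := Module.Finite.iff_fg.mpr hEfg
  haveI : Module.Finite S V := inferInstance
  haveI : Module.Finite (S ⧸ 𝔪) V := Module.Finite.of_restrictScalars_finite S (S ⧸ 𝔪) V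
  have hlen_eq : Module.length S V = Module.length (S ⧸ 𝔪) V :=
    Module.length_eq_of_surjective (R := S ⧸ 𝔪) (M := V) Ideal.Quotient.mk_surjective
  -- the residues of the `wᵢ` are `k`-linearly independent in `V`
  let gE : Fin m → E := fun i => ⟨g i, Submodule.subset_span (Set.mem_insert_of_mem _ ⟨i, rfl⟩)⟩
  let v : Fin m → V := fun i => ⟨ψ (gE i), hψV (gE i)⟩
  have hsum : ∀ c : Fin m → S, ((∑ i, c i • v i : V) : ResidueField W) = ψ (∑ i, c i • gE i) := by
    intro c
    rw [map_sum]
    simp only [map_smul]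
    rw [Submodule.coe_sum]
    simp only [Submodule.coe_smul, v]
  have hιsum : ∀ c : Fin m → S, ι ((∑ i, c i • gE i : E) : K) = ∑ i, j (c i) * w i := by
    intro c
    rw [Submodule.coe_sum, map_sum]
    refine Finset.sum_congr rfl fun i _ => ?_
    rw [Submodule.coe_smul, Algebra.smul_def, map_mul, hι]
    change j (c i) * ι (g i) = _
    rw [hg]
  have hvind : LinearIndependent (S ⧸ 𝔪) v := by
    rw [Fintype.linearIndependent_iff]
    intro gk hgk i
    -- lift the coefficients to `S`
    choose c hc using fun i => Ideal.Quotient.mk_surjective (gk i)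
    have hck : ∀ i, gk i • v i = c i • v i := fun i => by
      rw [← hc i]; exact Module.IsTorsionBySet.mk_smul hV (c i) (v i)
    simp only [hck] at hgk
    have h0 : ψ (∑ i, c i • gE i) = 0 := by
      rw [← hsum c, hgk]; rfl
    rw [hψ, residue_eq_zero_iff, ValuationSubring.valuation_lt_one_iff] at h0
    change W.valuation (ι ((∑ i, c i • gE i : E) : K)) < 1 at h0
    rw [hιsum] at h0
    have hi := hind c h0 i
    rw [← hc i, Ideal.Quotient.eq_zero_iff_mem, hmem𝔪]
    exact hi
  have hcard : m ≤ Module.finrank (S ⧸ 𝔪) V := by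
    simpa using hvind.fintype_card_le_finrank
  calc (m : ℕ∞) ≤ (Module.finrank (S ⧸ 𝔪) V : ℕ∞) := by exact_mod_cast hcard
    _ = Module.length (S ⧸ 𝔪) V := (Module.length_eq_finrank (S ⧸ 𝔪) V).symm
    _ = Module.length S V := hlen_eq.symm
    _ ≤ Module.length S (S ⧸ Ideal.span {d}) := hlenV

end KrullAkizuki

end Summit.ResolutionOfSingularities.ResolutionOfSingularities.Cruxes.SigmaMaxModifications.IdeasL1C5

end
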